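import Summits.Ventures.LatticeQCDFlow.Scaling.SmallBallChart

/-!
# LatticeQCDFlow / Scaling — exact small-ball asymptotics from a chart with distortion `→ 1` (file 2 of 2): the limit

HONEST FRAMING: exact (Metropolis-corrected) sampling algorithms for lattice gauge theory; figures of merit are
autocorrelation/cost numbers at stated couplings and volumes; no continuum-physics claim.

Venture `LatticeQCDFlow` (cell pub-lqcd), topic `Scaling`, FANOUT row 30 (lean-1) — OUR WORK, sequel of
`Scaling/SmallBallChart.lean` (setting and hypotheses as in its module docstring: a finite Borel measure `σ` on a
metric space `X` with centre-free ball masses charging every ball about `x₀`; a finite-dimensional real normed space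
`E` (`dim E = k`) with an additive Haar measure `μ`; a chart `φ : E → X`, `φ 0 = x₀`, continuous on `B̄(0, r₀)`,
which for every `ε > 0` is `(1+ε)`-Lipschitz and `(1+ε)`-co-Lipschitz on some ball `B̄(0, r_ε)`, `0 < r_ε ≤ r₀`, and
fills `B̄(x₀, s) ⊆ φ(B̄(0, Λ₀ s))` for `0 ≤ s ≤ r₀`).

* `exists_tendsto_ratio` — `σ(B̄(x₀,t))/μ(b̄(0,t)) → c ∈ (0, ∞)` (`t → 0⁺`): Lebesgue–Besicovitch differentiation
  of the chart measure at ONE density point per scale + the two-sided squeeze give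
  `limsup ≤ (1+ε)^{2k}·liminf` for every `ε > 0`; positivity by the Vitali covering lemma;
* `exists_tendsto_measure_closedBall_div_pow` — `σ(B̄(x₀,t))/t^k → C₀ ∈ (0, ∞)`;
* `two_sided_of_tendsto` — ANY centre-free `σ` with `σ(B̄(x₀,t))/t^κ → C₀ > 0` satisfies, for every `ε > 0`,
  `a·t^κ ≤ σ(B̄(x,t)) ≤ A·t^κ` (`0 < t ≤ r₁`, all `x`) with `0 < a`, `A ≤ (1+ε)·a` — the literal shape of theory-2's
  `SmallBallAsymptotics` (`Scaling/CalibratedWindowSteps.lean`), not imported here;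
* `smallBall_two_sided` — the chart hypotheses imply that shape with `κ = dim E`.

Elementary measure theory on top of Mathlib (`Besicovitch.ae_tendsto_rnDeriv`, `VitaliFamily.measure_le_of_frequently_le`,
`Measure.addHaar_closedBall'`); the argument is that of `Literature/…/UnitaryCayleyChart` §Limit (Chatterjee,
arXiv:1602.01222 §6/§11, there for the Cayley chart of `U(N)`), made abstract; no definition is introduced and
nothing is cited as a fact.
-/

noncomputable section

open MeasureTheory Measure Metric Filter Topology Set Function
open Literature.MathematicalPhysics.QuantumFieldTheory.UnitaryCayley (tendsto_const_mul_nhdsGT)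
open scoped ENNReal NNReal Topology

namespace Summit.Ventures.LatticeQCDFlow.Theory2.Lattice.SmallBallChart

variable {X : Type*} [MetricSpace X] {E : Type*} [NormedAddCommGroup E]

/-! ## §4. The small-ball limit -/

section Limit

variable [MeasurableSpace X] [BorelSpace X] [NormedSpace ℝ E] [FiniteDimensional ℝ E] [MeasurableSpace E]
  [BorelSpace E]

/-- **Existence of the small-ball constant.**  Under the chart hypotheses of the module docstring the ratio
`g(t) = σ(B̄(x₀, t))/μ(b̄(0, t))` converges, as `t → 0⁺`, to some `c ∈ (0, ∞)`: at one `μ`-density point `a` of the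
chart measure `ν` at a scale where the chart is `(1+ε)`-bi-Lipschitz the squeeze gives `limsup g ≤ (1+ε)^k·R_a` and
`R_a ≤ (1+ε)^k·liminf g` (`k = dim E`), so `limsup g ≤ (1+ε)^{2k}·liminf g` for every `ε > 0`; positivity by the
Vitali covering lemma. [folklore] -/
theorem exists_tendsto_ratio (σ : Measure X) [IsFiniteMeasure σ] (μ : Measure E) [μ.IsAddHaarMeasure]
    {φ : E → X} {x₀ : X} {r₀ Λ₀ : ℝ}
    (hball : ∀ (x : X) (ρ : ℝ), σ (closedBall x ρ) = σ (closedBall x₀ ρ))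
    (hpos : ∀ ρ : ℝ, 0 < ρ → 0 < σ (closedBall x₀ ρ))
    (hφ0 : φ 0 = x₀) (hcont : ContinuousOn φ (closedBall 0 r₀))
    (hchart : ∀ ε : ℝ, 0 < ε → ∃ r : ℝ, 0 < r ∧ r ≤ r₀ ∧
      (∀ a ∈ closedBall (0 : E) r, ∀ b ∈ closedBall (0 : E) r, dist (φ a) (φ b) ≤ (1 + ε) * ‖a - b‖) ∧
      (∀ a ∈ closedBall (0 : E) r, ∀ b ∈ closedBall (0 : E) r, ‖a - b‖ ≤ (1 + ε) * dist (φ a) (φ b)))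
    (hΛ₀ : 1 ≤ Λ₀) (hfill : ∀ s : ℝ, 0 ≤ s → s ≤ r₀ → closedBall x₀ s ⊆ φ '' closedBall 0 (Λ₀ * s)) :
    ∃ c : ℝ≥0∞, c ≠ 0 ∧ c ≠ ∞ ∧
      Tendsto (fun t : ℝ => σ (closedBall x₀ t) / μ (closedBall (0 : E) t)) (𝓝[>] 0) (𝓝 c) := by
  -- the top scale `r₁`: the chart is `2`-bi-Lipschitz on `b̄(0, r₁)`
  obtain ⟨r₁, hr₁, hr₁r₀, hlip₁', hco₁'⟩ := hchart 1 one_pos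
  have hlip₁ : ∀ a ∈ closedBall (0 : E) r₁, ∀ b ∈ closedBall (0 : E) r₁, dist (φ a) (φ b) ≤ 2 * ‖a - b‖ :=
    fun a ha b hb => (hlip₁' a ha b hb).trans_eq (by norm_num)
  have hco₁ : ∀ a ∈ closedBall (0 : E) r₁, ∀ b ∈ closedBall (0 : E) r₁, ‖a - b‖ ≤ 2 * dist (φ a) (φ b) :=
    fun a ha b hb => (hco₁' a ha b hb).trans_eq (by norm_num)
  have hfill₁ : ∀ s : ℝ, 0 ≤ s → s ≤ r₁ → closedBall x₀ s ⊆ φ '' closedBall 0 (Λ₀ * s) :=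
    fun s hs hs1 => hfill s hs (hs1.trans hr₁r₀)
  -- the chart measure
  have hinj : InjOn φ (closedBall 0 r₁) := by
    intro a ha b hb hab
    have h := hco₁ a ha b hb
    rw [hab, dist_self, mul_zero, norm_le_zero_iff, sub_eq_zero] at h
    exact h
  obtain ⟨ν, hνfin, hν⟩ := exists_chartMeasure σ (hcont.mono (closedBall_subset_closedBall hr₁r₀)) hinj
  set k := Module.finrank ℝ E with hk
  set g : ℝ → ℝ≥0∞ := fun t => σ (closedBall x₀ t) / μ (closedBall (0 : E) t) with hg
  set M := limsup g (𝓝[>] 0) with hM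
  set L := liminf g (𝓝[>] 0) with hL
  have hΛ₀0 : 0 < Λ₀ := by linarith
  -- Step 1: at every scale `r ≤ r₁` with bi-Lipschitz constant `Λ ∈ [1, 2]`, a good point gives
  -- `R ≤ Λ^k L` and `M ≤ Λ^k R`.
  have key : ∀ r Λ : ℝ, 0 < r → r ≤ r₁ → 1 ≤ Λ → Λ ≤ 2 →
      (∀ a ∈ closedBall (0 : E) r, ∀ b ∈ closedBall (0 : E) r, dist (φ a) (φ b) ≤ Λ * ‖a - b‖) →
      (∀ a ∈ closedBall (0 : E) r, ∀ b ∈ closedBall (0 : E) r, ‖a - b‖ ≤ Λ * dist (φ a) (φ b)) →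
      ∃ R : ℝ≥0∞, R < ∞ ∧ R ≤ ENNReal.ofReal (Λ ^ k) * L ∧ M ≤ ENNReal.ofReal (Λ ^ k) * R := by
    intro r Λ hr hrr₁ hΛr1 hΛr2 hlip hco
    have hρ : 0 < r / (8 * Λ₀) := by positivity
    obtain ⟨a, ha, R, hRfin, hR⟩ := exists_good_point μ ν hρ
    have hΛr0 : 0 < Λ := by linarith
    set K := ENNReal.ofReal (Λ ^ k) with hK
    have hK0 : K ≠ 0 := by rw [hK, ENNReal.ofReal_ne_zero_iff]; positivity
    have hKtop : K ≠ ∞ := ENNReal.ofReal_ne_top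
    refine ⟨R, hRfin, ?_, ?_⟩
    · -- `K⁻¹ · Ratio(a, t/Λ) ≤ g(t)` for small `t`, and the left side tends to `K⁻¹ R`
      have hT : Tendsto (fun t => K⁻¹ * (ν (closedBall a (Λ⁻¹ * t)) / μ (closedBall a (Λ⁻¹ * t))))
          (𝓝[>] 0) (𝓝 (K⁻¹ * R)) :=
        ENNReal.Tendsto.const_mul (hR.comp (tendsto_const_mul_nhdsGT (inv_pos.2 hΛr0)))
          (Or.inr (ENNReal.inv_ne_top.2 hK0))
      have hle : K⁻¹ * R ≤ L := by
        rw [← hT.liminf_eq]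
        refine liminf_le_liminf ?_
        filter_upwards [Ioc_mem_nhdsGT hρ] with t ht
        have hδ : 0 < Λ⁻¹ * t := mul_pos (inv_pos.2 hΛr0) ht.1
        have hδt : Λ⁻¹ * t ≤ t := by
          rw [inv_mul_le_iff₀ hΛr0]; exact le_mul_of_one_le_left ht.1.le hΛr1
        have har : ‖a‖ + Λ⁻¹ * t ≤ r := by
          have h8 : r / (8 * Λ₀) ≤ r / 8 := div_le_div_of_nonneg_left hr.le (by norm_num) (by linarith)
          linarith [ht.2]
        have h := ratio_le (μ := μ) hν hball hΛr1 hlip hδ har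
        rw [mul_inv_cancel_left₀ hΛr0.ne'] at h
        calc K⁻¹ * (ν (closedBall a (Λ⁻¹ * t)) / μ (closedBall a (Λ⁻¹ * t)))
            ≤ K⁻¹ * (K * g t) := mul_le_mul_right h _
          _ = g t := by rw [← mul_assoc, ENNReal.inv_mul_cancel hK0 hKtop, one_mul]
      calc R = K * (K⁻¹ * R) := by rw [← mul_assoc, ENNReal.mul_inv_cancel hK0 hKtop, one_mul]
        _ ≤ K * L := mul_le_mul_right hle _
    · -- `g(t) ≤ K · Ratio(a, Λ t)` for small `t`, and the right side tends to `K R`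
      have hT : Tendsto (fun t => K * (ν (closedBall a (Λ * t)) / μ (closedBall a (Λ * t))))
          (𝓝[>] 0) (𝓝 (K * R)) :=
        ENNReal.Tendsto.const_mul (hR.comp (tendsto_const_mul_nhdsGT hΛr0)) (Or.inr hKtop)
      rw [← hT.limsup_eq]
      refine limsup_le_limsup ?_
      have hρ' : 0 < r / (8 * Λ₀) / Λ := div_pos hρ hΛr0
      filter_upwards [Ioc_mem_nhdsGT hρ'] with t ht
      exact measureRatio_le (μ := μ) hν hball hφ0 hlip hco hfill₁ hΛr1 hΛr2 hΛ₀ hr hrr₁ ha ht.1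
        (by rw [← le_div_iff₀' hΛr0]; exact ht.2)
  -- Step 2: `M < ∞` and `M ≤ L`.
  obtain ⟨R₀, hR₀fin, -, hMR₀⟩ := key r₁ 2 hr₁ le_rfl (by norm_num) le_rfl hlip₁ hco₁
  have hMfin : M < ∞ := lt_of_le_of_lt hMR₀ (ENNReal.mul_lt_top ENNReal.ofReal_lt_top hR₀fin)
  have hLM : L ≤ M := liminf_le_limsup
  have hLfin : L < ∞ := lt_of_le_of_lt hLM hMfin
  have hML : M ≤ L := by
    have hreal : ∀ ε : ℝ, 0 < ε → ε ≤ 1 → M.toReal ≤ (1 + ε) ^ k * ((1 + ε) ^ k * L.toReal) := by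
      intro ε hε hε1
      obtain ⟨r, hr, -, hlip, hco⟩ := hchart ε hε
      -- restrict to the scale `min r r₁`
      have hsub : closedBall (0 : E) (min r r₁) ⊆ closedBall 0 r := closedBall_subset_closedBall (min_le_left _ _)
      obtain ⟨R, -, hRL, hMR⟩ := key (min r r₁) (1 + ε) (lt_min hr hr₁) (min_le_right _ _) (by linarith)
        (by linarith) (fun a ha b hb => hlip a (hsub ha) b (hsub hb)) (fun a ha b hb => hco a (hsub ha) b (hsub hb))
      have hΛk : 0 ≤ (1 + ε) ^ k := pow_nonneg (by linarith) _
      have h1 : M ≤ ENNReal.ofReal ((1 + ε) ^ k) * (ENNReal.ofReal ((1 + ε) ^ k) * L) :=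
        hMR.trans (mul_le_mul_right hRL _)
      have h2 := ENNReal.toReal_mono (ENNReal.mul_ne_top ENNReal.ofReal_ne_top
        (ENNReal.mul_ne_top ENNReal.ofReal_ne_top hLfin.ne)) h1
      rwa [ENNReal.toReal_mul, ENNReal.toReal_mul, ENNReal.toReal_ofReal hΛk] at h2
    have hlim : Tendsto (fun ε : ℝ => (1 + ε) ^ k * ((1 + ε) ^ k * L.toReal)) (𝓝[>] 0)
        (𝓝 ((1 + 0 : ℝ) ^ k * ((1 + 0 : ℝ) ^ k * L.toReal))) := by
      have hc : Continuous fun ε : ℝ => (1 + ε) ^ k * ((1 + ε) ^ k * L.toReal) := by fun_prop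
      exact hc.continuousAt.tendsto.mono_left nhdsWithin_le_nhds
    rw [add_zero, one_pow, one_mul, one_mul] at hlim
    have hle : M.toReal ≤ L.toReal :=
      ge_of_tendsto hlim (by
        filter_upwards [Ioc_mem_nhdsGT one_pos] with ε hε
        exact hreal ε hε.1 hε.2)
    exact (ENNReal.toReal_le_toReal hMfin.ne hLfin.ne).1 hle
  -- Step 3: the limit exists and equals `M`.
  have hT : Tendsto g (𝓝[>] 0) (𝓝 M) := tendsto_of_le_liminf_of_limsup_le hML le_rfl
  refine ⟨M, ?_, hMfin.ne, hT⟩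
  -- Step 4: `M ≠ 0` by the Vitali covering lemma on the ball `b̄(0, r₁/(8Λ₀))`.
  intro hM0
  rw [hM0] at hT
  haveI := hνfin
  have hρ : 0 < r₁ / (8 * Λ₀) := by positivity
  set S : Set E := closedBall 0 (r₁ / (8 * Λ₀)) with hS
  have hSpos : 0 < ν S := by
    have h := measure_closedBall_le_chartMeasure (ν := ν) hν hball hφ0 hlip₁ hco₁ hfill₁ (by norm_num)
      le_rfl hΛ₀ hr₁ le_rfl (a := 0) (by rw [norm_zero]; exact hρ.le) hρ.le le_rfl
    exact lt_of_lt_of_le (hpos _ (div_pos hρ two_pos)) h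
  have hSfin : μ S ≠ ∞ := measure_closedBall_lt_top.ne
  obtain ⟨ε, hε, hεS⟩ := ENNReal.exists_nnreal_pos_mul_lt hSfin hSpos.ne'
  set K := ENNReal.ofReal ((2 : ℝ) ^ k) with hK
  have hKtop : K ≠ ∞ := ENNReal.ofReal_ne_top
  -- every point of `S` has arbitrarily small balls with `ν ≤ ε μ`
  have hfreq : ∀ x ∈ S, ∃ᶠ t in (Besicovitch.vitaliFamily ν).filterAt x, ν t ≤ (ε • μ) t := by
    intro x hx
    rw [hS, mem_closedBall, dist_zero_right] at hx
    have hT' : Tendsto (fun δ => K * g (2 * δ)) (𝓝[>] 0) (𝓝 (K * 0)) :=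
      ENNReal.Tendsto.const_mul (hT.comp (tendsto_const_mul_nhdsGT two_pos)) (Or.inr hKtop)
    rw [mul_zero] at hT'
    have hev : ∀ᶠ δ in 𝓝[>] (0 : ℝ), ν (closedBall x δ) ≤ (ε • μ) (closedBall x δ) := by
      filter_upwards [hT'.eventually_lt_const (show (0 : ℝ≥0∞) < ε by exact_mod_cast hε),
        Ioc_mem_nhdsGT hρ] with δ hδ hδ0
      have har : ‖x‖ + δ ≤ r₁ := by
        have h8 : r₁ / (8 * Λ₀) ≤ r₁ / 8 := div_le_div_of_nonneg_left hr₁.le (by norm_num) (by linarith)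
        linarith [hδ0.2]
      have h := (ratio_le (μ := μ) hν hball (by norm_num : (1 : ℝ) ≤ 2) hlip₁ hδ0.1 har).trans_lt hδ
      rw [ENNReal.div_lt_iff (Or.inl (Metric.measure_closedBall_pos μ x hδ0.1).ne')
        (Or.inl measure_closedBall_lt_top.ne)] at h
      rw [Measure.coe_nnreal_smul_apply]
      exact h.le
    exact (Besicovitch.tendsto_filterAt ν x).frequently hev.frequently
  have hle := (Besicovitch.vitaliFamily ν).measure_le_of_frequently_le (ε • μ)
    Measure.AbsolutelyContinuous.rfl S hfreq
  rw [Measure.coe_nnreal_smul_apply] at hle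
  exact absurd hle (not_le.2 hεS)

end Limit

/-! ## §5. Real form and the two-sided `SmallBallAsymptotics` shape -/

section TwoSided

variable [MeasurableSpace X]

/-- **From a limit to the two-sided shape.**  If the balls of `σ` have centre-free mass and
`σ(B̄(x₀, t))/t^κ → C₀ > 0` as `t → 0⁺`, then for every `ε > 0` there are `r₁ > 0`, `0 < a`, `A ≤ (1 + ε)·a` with
`a·t^κ ≤ σ(B̄(x, t)) ≤ A·t^κ` for all `x` and `0 < t ≤ r₁` (`a = (1 - θ)C₀`, `A = (1 + θ)C₀`, `θ = ε/(2 + ε)`).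
[folklore] -/
theorem two_sided_of_tendsto {σ : Measure X} {x₀ : X} {κ : ℕ} {C₀ : ℝ}
    (hball : ∀ (x : X) (ρ : ℝ), σ (closedBall x ρ) = σ (closedBall x₀ ρ)) (hC₀ : 0 < C₀)
    (hT : Tendsto (fun t : ℝ => (σ (closedBall x₀ t)).toReal / t ^ κ) (𝓝[>] 0) (𝓝 C₀)) :
    ∀ ε : ℝ, 0 < ε → ∃ r₁ a A : ℝ, 0 < r₁ ∧ 0 < a ∧ A ≤ (1 + ε) * a ∧
      ∀ (x : X) (t : ℝ), 0 < t → t ≤ r₁ →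
        a * t ^ κ ≤ (σ (closedBall x t)).toReal ∧ (σ (closedBall x t)).toReal ≤ A * t ^ κ := by
  intro ε hε
  set θ := ε / (2 + ε) with hθ
  have hθ0 : 0 < θ := by positivity
  have hθ1 : θ < 1 := by rw [hθ, div_lt_one (by linarith)]; linarith
  have hev : ∀ᶠ t in 𝓝[>] (0 : ℝ), dist ((σ (closedBall x₀ t)).toReal / t ^ κ) C₀ < θ * C₀ :=
    Metric.tendsto_nhds.1 hT _ (by positivity)
  obtain ⟨η, hη, hηt⟩ := Metric.eventually_nhds_iff.1 (eventually_nhdsWithin_iff.1 hev)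
  refine ⟨η / 2, (1 - θ) * C₀, (1 + θ) * C₀, by positivity, by nlinarith, ?_, fun x t ht htη => ?_⟩
  · have : (1 + θ) = (1 + ε) * (1 - θ) := by
      rw [hθ]; field_simp; ring
    rw [this, mul_assoc]
  · have h := hηt (by rw [dist_zero_right, Real.norm_eq_abs, abs_of_pos ht]; linarith) (show t ∈ Ioi (0 : ℝ) from ht)
    rw [hball x t]
    rw [Real.dist_eq, abs_lt] at h
    have htk : 0 < t ^ κ := pow_pos ht κ
    constructor
    · have h1 : (1 - θ) * C₀ ≤ (σ (closedBall x₀ t)).toReal / t ^ κ := by linarith [h.1]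
      exact (le_div_iff₀ htk).1 h1
    · have h1 : (σ (closedBall x₀ t)).toReal / t ^ κ ≤ (1 + θ) * C₀ := by linarith [h.2]
      exact (div_le_iff₀ htk).1 h1

variable [BorelSpace X] [NormedSpace ℝ E] [FiniteDimensional ℝ E] [MeasurableSpace E] [BorelSpace E]

/-- **The small-ball limit in real form**: under the chart hypotheses, `σ(B̄(x₀, t))/t^{dim E} → C₀ ∈ (0, ∞)` as
`t → 0⁺` (`C₀ = c·μ(b̄(0,1))` with `c` the constant of `exists_tendsto_ratio`). [folklore] -/
theorem exists_tendsto_measure_closedBall_div_pow (σ : Measure X) [IsFiniteMeasure σ] (μ : Measure E)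
    [μ.IsAddHaarMeasure] {φ : E → X} {x₀ : X} {r₀ Λ₀ : ℝ}
    (hball : ∀ (x : X) (ρ : ℝ), σ (closedBall x ρ) = σ (closedBall x₀ ρ))
    (hpos : ∀ ρ : ℝ, 0 < ρ → 0 < σ (closedBall x₀ ρ))
    (hφ0 : φ 0 = x₀) (hcont : ContinuousOn φ (closedBall 0 r₀))
    (hchart : ∀ ε : ℝ, 0 < ε → ∃ r : ℝ, 0 < r ∧ r ≤ r₀ ∧
      (∀ a ∈ closedBall (0 : E) r, ∀ b ∈ closedBall (0 : E) r, dist (φ a) (φ b) ≤ (1 + ε) * ‖a - b‖) ∧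
      (∀ a ∈ closedBall (0 : E) r, ∀ b ∈ closedBall (0 : E) r, ‖a - b‖ ≤ (1 + ε) * dist (φ a) (φ b)))
    (hΛ₀ : 1 ≤ Λ₀) (hfill : ∀ s : ℝ, 0 ≤ s → s ≤ r₀ → closedBall x₀ s ⊆ φ '' closedBall 0 (Λ₀ * s)) :
    ∃ C₀ : ℝ, 0 < C₀ ∧
      Tendsto (fun t : ℝ => (σ (closedBall x₀ t)).toReal / t ^ Module.finrank ℝ E) (𝓝[>] 0) (𝓝 C₀) := by
  obtain ⟨c, hc0, hctop, hT⟩ := exists_tendsto_ratio σ μ hball hpos hφ0 hcont hchart hΛ₀ hfill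
  set V := μ (closedBall (0 : E) 1) with hV
  have hV0 : V ≠ 0 := (Metric.measure_closedBall_pos μ 0 one_pos).ne'
  have hVtop : V ≠ ∞ := measure_closedBall_lt_top.ne
  have hVr : 0 < V.toReal := ENNReal.toReal_pos hV0 hVtop
  refine ⟨c.toReal * V.toReal, mul_pos (ENNReal.toReal_pos hc0 hctop) hVr, ?_⟩
  have hT' : Tendsto (fun t : ℝ => (σ (closedBall x₀ t) / μ (closedBall (0 : E) t)).toReal * V.toReal)
      (𝓝[>] 0) (𝓝 (c.toReal * V.toReal)) :=
    ((ENNReal.tendsto_toReal hctop).comp hT).mul tendsto_const_nhds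
  refine hT'.congr' ?_
  filter_upwards [self_mem_nhdsWithin] with t (ht : 0 < t)
  have htk : 0 < t ^ Module.finrank ℝ E := pow_pos ht _
  rw [Measure.addHaar_closedBall' μ (0 : E) ht.le, ENNReal.toReal_div, ENNReal.toReal_mul,
    ENNReal.toReal_ofReal htk.le, ← hV]
  field_simp

/-- **The two-sided small-ball asymptotics from a chart** (the shape of theory-2's `SmallBallAsymptotics` with
`κ = dim E`): for every `ε > 0` there are `r₁ > 0`, `0 < a`, `A ≤ (1 + ε)·a` with
`a·t^{dim E} ≤ σ(B̄(x, t)) ≤ A·t^{dim E}` for all `x` and all `0 < t ≤ r₁`. [folklore] -/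
theorem smallBall_two_sided (σ : Measure X) [IsFiniteMeasure σ] (μ : Measure E)
    [μ.IsAddHaarMeasure] {φ : E → X} {x₀ : X} {r₀ Λ₀ : ℝ}
    (hball : ∀ (x : X) (ρ : ℝ), σ (closedBall x ρ) = σ (closedBall x₀ ρ))
    (hpos : ∀ ρ : ℝ, 0 < ρ → 0 < σ (closedBall x₀ ρ))
    (hφ0 : φ 0 = x₀) (hcont : ContinuousOn φ (closedBall 0 r₀))
    (hchart : ∀ ε : ℝ, 0 < ε → ∃ r : ℝ, 0 < r ∧ r ≤ r₀ ∧
      (∀ a ∈ closedBall (0 : E) r, ∀ b ∈ closedBall (0 : E) r, dist (φ a) (φ b) ≤ (1 + ε) * ‖a - b‖) ∧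
      (∀ a ∈ closedBall (0 : E) r, ∀ b ∈ closedBall (0 : E) r, ‖a - b‖ ≤ (1 + ε) * dist (φ a) (φ b)))
    (hΛ₀ : 1 ≤ Λ₀) (hfill : ∀ s : ℝ, 0 ≤ s → s ≤ r₀ → closedBall x₀ s ⊆ φ '' closedBall 0 (Λ₀ * s)) :
    ∀ ε : ℝ, 0 < ε → ∃ r₁ a A : ℝ, 0 < r₁ ∧ 0 < a ∧ A ≤ (1 + ε) * a ∧
      ∀ (x : X) (t : ℝ), 0 < t → t ≤ r₁ →
        a * t ^ Module.finrank ℝ E ≤ (σ (closedBall x t)).toReal ∧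
          (σ (closedBall x t)).toReal ≤ A * t ^ Module.finrank ℝ E := by
  obtain ⟨C₀, hC₀, hT⟩ := exists_tendsto_measure_closedBall_div_pow σ μ hball hpos hφ0 hcont hchart hΛ₀
    hfill
  exact two_sided_of_tendsto hball hC₀ hT

end TwoSided

end Summit.Ventures.LatticeQCDFlow.Theory2.Lattice.SmallBallChart

end
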